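import Summits.AtomisticToContinuum.FouriersLaw.Theses.CageBudgetFekete
import Summits.AtomisticToContinuum.FouriersLaw.Theses.HoelderEscapeProfile
import Summits.AtomisticToContinuum.FouriersLaw.Theorems.HoelderEscapeProfileFibreCalculus
import Summits.AtomisticToContinuum.FouriersLaw.Theorems.CageBudgetFeketeUnboundedHeatVarianceAbelForm
import Summits.AtomisticToContinuum.FouriersLaw.Theorems.CageBudgetFeketeUnboundedHeatVarianceAbelSandwichTransfer
import Summits.AtomisticToContinuum.FouriersLaw.Theorems.HoelderEscapeProfileCornerNoDipSeam
import HarnessLib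

/-!
# Stub `stub_infraredNonFreezing_of_unboundedHeatVariance` of line `Sketch` — the necessity edge U ⟹ IR
(crux `CageBudgetFekete.UnboundedHeatVariance`, item stmt-AtomisticToContinuum-15771; `--supports` file)

WHAT. The registered stub N of the skeleton `Cruxes/UnboundedHeatVariance/Lines/Sketch.lean`: if the crux U
(`CageBudgetFekete.UnboundedHeatVariance`) holds, then in every arena of the crux the INFRARED NON-FREEZING (IR) of
the Abel energy profile holds: for every level `M` and every `ν₁ > 0` there are a wavenumber `k` with `cos k ≠ 1`
and an Abel parameter `0 < ν < ν₁` with `M(2 − 2cos k) ≤ χ(k) − f̂_ν(k)`. So the line's ergodic stub IR loses no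
strength.

HOW. By the landed Abel form of the crux (`Birth.unboundedHeatVariance_iff_abel`) U gives
`ν⁻¹A(ν) → +∞` (`A(ν) = ∫₀^∞ e^{-νt} C_T`), so ONE small `ν < ν₁` has `ν⁻¹A(ν) ≥ max M 0 + 1`. The landed fibre
calculus (`FibreCalculusSketch.fibreCalculus_proof`, clauses 4, 5, 7, 12) supplies the weighted summabilities of
`a = S̄_ν`, `b = S(·,0)`, the conservation law `Σ a = Σ b` and Helfand–Abel `ν⁻¹A(ν) = Σ_x (x²/2)Δ(x)` for the
displacement `Δ = a − b`; the landed `Sketch.tsum_one_sub_cos_mul_sub` gives `χ(k) − f̂_ν(k) = Σ_x (1 − cos kx)Δ(x)`.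
THE ANALYSIS (this file): the Fejér weight `w_k(x) = (1 − cos kx)/(2 − 2cos k)` equals
`(x²/2)·sinc²(kx/2)/sinc²(k/2)` off `cos k = 1`, hence tends to `x²/2` as `k → 0`, and satisfies
`0 ≤ w_k(x) ≤ x²/2` for integer `x` (lattice Fejér inequality, the LANDED
`CornerNoDip.HeatProfile.one_sub_cos_int_mul_le` of `HoelderEscapeProfileCornerNoDipSeam.lean`); Tannery's theorem
(`tendsto_tsum_of_dominated_convergence`, domination by `(1+x²)|Δ x|`) gives
`Σ_x w_k(x)Δ(x) → Σ_x (x²/2)Δ(x) = ν⁻¹A(ν) > max M 0` as `k → 0`, so some `0 < k < 1` has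
`χ(k) − f̂_ν(k) = (2 − 2cos k)·Σ_x w_k(x)Δ(x) ≥ M(2 − 2cos k)`. No light cone is needed.

No definitions; pure real-analysis helper lemmas (public, for reuse by the line) first, then the stub.
prover-line-stmt-AtomisticToContinuum-15771-c1-0, 2026-08-17.
-/

noncomputable section

namespace Summit.AtomisticToContinuum.FouriersLaw.Theorems.UnboundedHeatVariance.Sketch

open MeasureTheory Set Filter Topology
open Literature.MathematicalPhysics.KineticTheory.HeatConduction
open Summit.AtomisticToContinuum.FouriersLaw.Theses

/-! ### 1. The Fejér weight `(1 − cos kx)/(2 − 2cos k)` on the lattice -/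

/-- `cos k ≠ 1` forces `0 < 2 − 2cos k`. [folklore] -/
theorem two_sub_two_mul_cos_pos {k : ℝ} (hk : Real.cos k ≠ 1) : 0 < 2 - 2 * Real.cos k := by
  have := lt_of_le_of_ne (Real.cos_le_one k) hk
  linarith

/-- **The Fejér weight is at most `x²/2` on the lattice.** For integer `x` and `cos k ≠ 1`:
`|(1 − cos kx)/(2 − 2cos k)| ≤ x²/2` (lattice Fejér inequality `1 − cos(kx) ≤ x²(1 − cos k)`, landed as
`CornerNoDip.HeatProfile.one_sub_cos_int_mul_le`). [folklore] -/
theorem abs_fejerWeight_le (x : ℤ) {k : ℝ} (hk : Real.cos k ≠ 1) :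
    |(1 - Real.cos (k * (x : ℝ))) / (2 - 2 * Real.cos k)| ≤ (x : ℝ) ^ 2 / 2 := by
  have hpos := two_sub_two_mul_cos_pos hk
  have h0 : 0 ≤ 1 - Real.cos (k * (x : ℝ)) := by linarith [Real.cos_le_one (k * (x : ℝ))]
  rw [abs_div, abs_of_nonneg h0, abs_of_pos hpos, div_le_iff₀ hpos]
  calc 1 - Real.cos (k * (x : ℝ)) ≤ (x : ℝ) ^ 2 * (1 - Real.cos k) :=
        CornerNoDip.HeatProfile.one_sub_cos_int_mul_le x k
    _ = (x : ℝ) ^ 2 / 2 * (2 - 2 * Real.cos k) := by ring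

/-! ### 2. The Fejér weight through `sinc`, and its limit at `k = 0` -/

/-- `1 − cos u = (u²/2)·sinc²(u/2)` (half-angle formula, and `sin y = y·sinc y` — cf. the landed
`Literature.Analysis.Fourier.sin_eq_mul_sinc`, inlined here to keep the import closure small). [folklore] -/
theorem one_sub_cos_eq_sq_mul_sinc_sq (u : ℝ) :
    1 - Real.cos u = u ^ 2 / 2 * Real.sinc (u / 2) ^ 2 := by
  have h1 : 1 - Real.cos u = 2 * Real.sin (u / 2) ^ 2 := by
    rw [Real.sin_sq_eq_half_sub]
    have : 2 * (u / 2) = u := by ring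
    rw [this]; ring
  rcases eq_or_ne u 0 with rfl | hu
  · simp
  · have hu2 : u / 2 ≠ 0 := div_ne_zero hu two_ne_zero
    rw [h1, Real.sinc_of_ne_zero hu2]
    field_simp

/-- **The Fejér weight through `sinc`.** Off the zero set `cos k = 1`:
`(1 − cos kx)/(2 − 2cos k) = (x²/2)·sinc²(kx/2)/sinc²(k/2)`. [folklore] -/
theorem fejerWeight_eq_sinc (k x : ℝ) (hk : Real.cos k ≠ 1) :
    (1 - Real.cos (k * x)) / (2 - 2 * Real.cos k) =
      x ^ 2 / 2 * Real.sinc (k * x / 2) ^ 2 / Real.sinc (k / 2) ^ 2 := by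
  have hk0 : k ≠ 0 := fun h => hk (by rw [h, Real.cos_zero])
  have h2 : 2 - 2 * Real.cos k = k ^ 2 * Real.sinc (k / 2) ^ 2 := by
    have := one_sub_cos_eq_sq_mul_sinc_sq k
    linarith
  have hs : Real.sinc (k / 2) ≠ 0 := by
    intro h0
    have : 2 - 2 * Real.cos k = 0 := by rw [h2, h0]; ring
    exact (two_sub_two_mul_cos_pos hk).ne' this
  rw [h2, one_sub_cos_eq_sq_mul_sinc_sq (k * x)]
  field_simp

/-- Near `0` (punctured), `cos k ≠ 1`. [folklore] -/
theorem eventually_cos_ne_one : ∀ᶠ k in 𝓝[≠] (0:ℝ), Real.cos k ≠ 1 := by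
  have h1 : ∀ᶠ k in 𝓝[≠] (0:ℝ), k ∈ Ioo (-(2 * Real.pi)) (2 * Real.pi) :=
    nhdsWithin_le_nhds (Ioo_mem_nhds (by linarith [Real.pi_pos]) (by linarith [Real.pi_pos]))
  filter_upwards [h1, self_mem_nhdsWithin] with k hk hk0
  rw [Ne, Real.cos_eq_one_iff_of_lt_of_lt hk.1 hk.2]
  exact hk0

/-- **Limit of the Fejér weight.** `(1 − cos kx)/(2 − 2cos k) → x²/2` as `k → 0`, `k ≠ 0`
(continuity of `sinc`). [folklore] -/
theorem tendsto_fejerWeight (x : ℝ) :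
    Tendsto (fun k : ℝ => (1 - Real.cos (k * x)) / (2 - 2 * Real.cos k)) (𝓝[≠] 0)
      (𝓝 (x ^ 2 / 2)) := by
  have hca : ContinuousAt
      (fun k : ℝ => x ^ 2 / 2 * Real.sinc (k * x / 2) ^ 2 / Real.sinc (k / 2) ^ 2) 0 := by
    refine ContinuousAt.div (by fun_prop) (by fun_prop) ?_
    simp
  have hlim := hca.tendsto
  simp only [zero_mul, zero_div, Real.sinc_zero, one_pow, mul_one, div_one] at hlim
  refine (hlim.mono_left nhdsWithin_le_nhds).congr' ?_
  filter_upwards [eventually_cos_ne_one] with k hk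
  exact (fejerWeight_eq_sinc k x hk).symm

/-- **Tannery for the Fejér-weighted displacement.** For `Δ : ℤ → ℝ` with `Σ(1+x²)|Δ x| < ∞`:
`Σ_x (1 − cos kx)/(2 − 2cos k)·Δ(x) → Σ_x (x²/2)Δ(x)` as `k → 0`, `k ≠ 0` (termwise limit
`tendsto_fejerWeight`, domination `|w_k(x)| ≤ x²/2 ≤ 1 + x²`, `tendsto_tsum_of_dominated_convergence`).
[folklore] -/
theorem tendsto_tsum_fejerWeight_mul {Δ : ℤ → ℝ}
    (hΔ : Summable (fun x : ℤ => (1 + (x : ℝ) ^ 2) * |Δ x|)) :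
    Tendsto (fun k : ℝ => ∑' x : ℤ, (1 - Real.cos (k * (x : ℝ))) / (2 - 2 * Real.cos k) * Δ x)
      (𝓝[≠] 0) (𝓝 (∑' x : ℤ, (x : ℝ) ^ 2 / 2 * Δ x)) := by
  refine tendsto_tsum_of_dominated_convergence (bound := fun x : ℤ => (1 + (x : ℝ) ^ 2) * |Δ x|) hΔ
    (fun x => (tendsto_fejerWeight (x : ℝ)).mul_const (Δ x)) ?_
  filter_upwards [eventually_cos_ne_one] with k hk x
  rw [Real.norm_eq_abs, abs_mul]
  refine mul_le_mul_of_nonneg_right ?_ (abs_nonneg _)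
  calc |(1 - Real.cos (k * (x : ℝ))) / (2 - 2 * Real.cos k)| ≤ (x : ℝ) ^ 2 / 2 := abs_fejerWeight_le x hk
    _ ≤ 1 + (x : ℝ) ^ 2 := by nlinarith [sq_nonneg (x : ℝ)]

/-- **Resummation.** Off `cos k = 1`, `Σ_x (1 − cos kx)Δ(x) = (2 − 2cos k)·Σ_x w_k(x)Δ(x)`. [folklore] -/
theorem tsum_one_sub_cos_mul_eq_mul_tsum_fejerWeight (Δ : ℤ → ℝ) {k : ℝ} (hk : Real.cos k ≠ 1) :
    ∑' x : ℤ, (1 - Real.cos (k * (x : ℝ))) * Δ x =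
      (2 - 2 * Real.cos k) * ∑' x : ℤ, (1 - Real.cos (k * (x : ℝ))) / (2 - 2 * Real.cos k) * Δ x := by
  rw [← tsum_mul_left]
  refine tsum_congr fun x => ?_
  rw [← mul_assoc, mul_div_cancel₀ _ (two_sub_two_mul_cos_pos hk).ne']

/-- **Infrared non-freezing from a large second moment (the `k → 0` step).** If `a, b : ℤ → ℝ` are
weighted-summable with equal sums and `max M 0 < Σ_x (x²/2)(a − b)(x)`, then some `0 < k < 1` (so `cos k ≠ 1`)
has `M(2 − 2cos k) ≤ Σcos(kx)b − Σcos(kx)a`. [folklore] -/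
theorem exists_infrared_deficit_of_sq_moment {a b : ℤ → ℝ}
    (ha : Summable (fun x : ℤ => (1 + (x : ℝ) ^ 2) * |a x|))
    (hb : Summable (fun x : ℤ => (1 + (x : ℝ) ^ 2) * |b x|))
    (hcons : ∑' x : ℤ, a x = ∑' x : ℤ, b x) {M : ℝ}
    (hM : max M 0 < ∑' x : ℤ, (x : ℝ) ^ 2 / 2 * (a x - b x)) :
    ∃ k : ℝ, Real.cos k ≠ 1 ∧ M * (2 - 2 * Real.cos k) ≤
      (∑' x : ℤ, Real.cos (k * (x : ℝ)) * b x) - ∑' x : ℤ, Real.cos (k * (x : ℝ)) * a x := by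
  have hT : Tendsto
      (fun k : ℝ => ∑' x : ℤ, (1 - Real.cos (k * (x : ℝ))) / (2 - 2 * Real.cos k) * (a x - b x))
      (𝓝[>] 0) (𝓝 (∑' x : ℤ, (x : ℝ) ^ 2 / 2 * (a x - b x))) :=
    (tendsto_tsum_fejerWeight_mul (weighted_summable_sub ha hb)).mono_left
      (nhdsWithin_mono _ fun k hk => hk.ne')
  have hk1 : ∀ᶠ k in 𝓝[>] (0:ℝ), k < 1 := nhdsWithin_le_nhds (Iio_mem_nhds one_pos)
  have hk0 : ∀ᶠ k in 𝓝[>] (0:ℝ), 0 < k := eventually_mem_nhdsWithin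
  obtain ⟨k, hMk, hk0, hk1⟩ := ((hT.eventually_const_lt hM).and (hk0.and hk1)).exists
  have hk : Real.cos k ≠ 1 := by
    rw [Ne, Real.cos_eq_one_iff_of_lt_of_lt (by linarith [Real.pi_pos]) (by linarith [Real.pi_gt_three])]
    exact hk0.ne'
  refine ⟨k, hk, ?_⟩
  rw [← tsum_one_sub_cos_mul_sub ha hb hcons k, tsum_one_sub_cos_mul_eq_mul_tsum_fejerWeight _ hk]
  have hpos := two_sub_two_mul_cos_pos hk
  have hMT : M ≤ ∑' x : ℤ, (1 - Real.cos (k * (x : ℝ))) / (2 - 2 * Real.cos k) * (a x - b x) :=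
    (le_max_left M 0).trans hMk.le
  calc M * (2 - 2 * Real.cos k)
      ≤ (∑' x : ℤ, (1 - Real.cos (k * (x : ℝ))) / (2 - 2 * Real.cos k) * (a x - b x)) *
          (2 - 2 * Real.cos k) := mul_le_mul_of_nonneg_right hMT hpos.le
    _ = (2 - 2 * Real.cos k) *
          ∑' x : ℤ, (1 - Real.cos (k * (x : ℝ))) / (2 - 2 * Real.cos k) * (a x - b x) := mul_comm _ _

/-! ### 3. The stub -/

/-- **N — `stub_infraredNonFreezing_of_unboundedHeatVariance` (registered signature, verbatim): the necessity
edge U ⟹ IR of line `Sketch`.** If `CageBudgetFekete.UnboundedHeatVariance` holds then, in every arena of the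
crux, for every level `M` and every `ν₁ > 0` some wavenumber `k` with `cos k ≠ 1` and some Abel parameter
`0 < ν < ν₁` satisfy `M(2 − 2cos k) ≤ χ(k) − f̂_ν(k)`: Abel form of U (`Birth.unboundedHeatVariance_iff_abel`),
fibre calculus (`FibreCalculusSketch.fibreCalculus_proof`: weighted summability, conservation, Helfand–Abel
`ν⁻¹A(ν) = Σ(x²/2)(S̄_ν − S(·,0))`), and the `k → 0` Tannery step `exists_infrared_deficit_of_sq_moment`.
[folklore] -/
theorem stub_infraredNonFreezing_of_unboundedHeatVariance :
    Summit.AtomisticToContinuum.FouriersLaw.Theses.CageBudgetFekete.UnboundedHeatVariance → ∀ ω₂ lam β γ : ℝ, 0 < ω₂ → 0 < lam → 0 < β → ∀ T : ℝ, 0 < T → ∀ μ : MeasureTheory.Measure Literature.MathematicalPhysics.KineticTheory.HeatConduction.ChainConfig, (Literature.MathematicalPhysics.KineticTheory.HeatConduction.pinnedChain ω₂ lam β γ).IsChainGibbsMeasure T μ → Literature.MathematicalPhysics.KineticTheory.HeatConduction.IsShiftInvariant μ → μ.map (fun σ : Literature.MathematicalPhysics.KineticTheory.HeatConduction.ChainConfig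 => fun x : ℤ => ((σ x).1, -(σ x).2)) = μ → ∀ D : Literature.MathematicalPhysics.KineticTheory.HeatConduction.InfiniteChainDynamics (Literature.MathematicalPhysics.KineticTheory.HeatConduction.pinnedChain ω₂ lam β γ), D.PreservesMeasure μ → (∀ t : ℝ, ∀ᵐ σ ∂μ, D.flow t (Literature.MathematicalPhysics.KineticTheory.HeatConduction.shift σ) = Literature.MathematicalPhysics.KineticTheory.HeatConduction.shift (D.flow t σ)) → (∀ t : ℝ, D.HasAbsConvergentCorrelation μ t) → Continuous (fun t : ℝ => D.currentCorrelation μ t) → ∀ h : Literature.MathematicalPhysics.KineticTheory.HeatConduction.ChainConfig → ℤ → ℝ, h = (fun (σ : Literature.MathematicalPhysics.KineticTheory.HeatConduction.ChainConfig) (x : ℤ) => (σ x).2 ^ 2 / 2 + (Literature.MathematicalPhysics.KineticTheory.HeatConduction.pinnedChain ω₂ lam β γ).U (σ x).1 + ((Literature.MathematicalPhysics.KineticTheory.HeatConduction.pinnedChain ω₂ lam β γ).V ((σ (x + 1)).1 - (σ x).1) + (Literature.MathematicalPhysics.KineticTheory.HeatConduction.pinnedChain ω₂ lam β γ).V ((σ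 x).1 - (σ (x - 1)).1)) / 2) → ∀ S : ℤ → ℝ → ℝ, S = (fun (x : ℤ) (t : ℝ) => ∫ σ, (h σ 0 - ∫ σ', h σ' 0 ∂μ) * (h (D.flow t σ) x - ∫ σ', h σ' 0 ∂μ) ∂μ) → ∀ Sb : ℝ → ℤ → ℝ, Sb = (fun (ν : ℝ) (x : ℤ) => ν * ∫ t in Set.Ioi (0:ℝ), Real.exp (-(ν * t)) * S x t) → ∀ fh : ℝ → ℝ → ℝ, fh = (fun (ν k : ℝ) => ∑' x : ℤ, Real.cos (k * (x : ℝ)) * Sb ν x) → ∀ χk : ℝ → ℝ, χk = (fun k : ℝ => ∑' x : ℤ, Real.cos (k * (x : ℝ)) * S x 0) → ∀ M ν₁ : ℝ, 0 < ν₁ → ∃ k : ℝ, Real.cos k ≠ 1 ∧ ∃ ν : ℝ, 0 < ν ∧ ν < ν₁ ∧ M * (2 - 2 * Real.cos k) ≤ χk k - fh ν k := by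
  intro hU ω₂ lam β γ hω hl hβ T hT μ hG hSI hRefl D hP hShift hAC hCc h hh S hS Sb hSb fh hfh χk hχk M ν₁ hν₁
  -- the Abel form of U in this arena: `ν⁻¹ A(ν) → +∞`
  have hA := Birth.unboundedHeatVariance_iff_abel.1 hU ω₂ lam β γ hω hl hβ T hT μ hG hSI hRefl D hP hShift
    hAC hCc
  -- fibre calculus: weighted summabilities, conservation, Helfand–Abel
  obtain ⟨-, -, -, h4, h5, -, h7, -, -, -, -, h12⟩ :=
    Summit.AtomisticToContinuum.FouriersLaw.Theorems.FibreCalculusSketch.fibreCalculus_proof ω₂ lam β γ hω hl hβ T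
      hT μ hG hSI hRefl D hP hShift h hh S hS Sb hSb _ rfl _ rfl fh hfh χk hχk
  -- ONE small `ν < ν₁` with `max M 0 + 1 ≤ ν⁻¹ A(ν)`
  have hev : ∀ᶠ ν in 𝓝[>] (0:ℝ),
      max M 0 + 1 ≤ ν⁻¹ * ∫ t in Ioi (0:ℝ), Real.exp (-(ν * t)) * D.currentCorrelation μ t :=
    (tendsto_atTop.1 hA) _
  have hpos : ∀ᶠ ν in 𝓝[>] (0:ℝ), 0 < ν := eventually_mem_nhdsWithin
  have hlt : ∀ᶠ ν in 𝓝[>] (0:ℝ), ν < ν₁ := nhdsWithin_le_nhds (Iio_mem_nhds hν₁)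
  obtain ⟨ν, hMν, hν, hνν₁⟩ := (hev.and (hpos.and hlt)).exists
  have ha := h4 ν hν
  -- conservation `Σ S̄_ν = Σ S(·,0)`
  have hχ0 : χk 0 = ∑' x : ℤ, S x 0 := by
    rw [hχk]
    simp only [zero_mul, Real.cos_zero, one_mul]
  have hcons : ∑' x : ℤ, Sb ν x = ∑' x : ℤ, S x 0 := (h7 ν hν).trans hχ0
  -- Helfand–Abel in the form `ν⁻¹ A(ν) = Σ (x²/2)(S̄_ν − S(·,0))`
  have hHelf : ν⁻¹ * ∫ t in Ioi (0:ℝ), Real.exp (-(ν * t)) * D.currentCorrelation μ t =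
      ∑' x : ℤ, (x : ℝ) ^ 2 / 2 * (Sb ν x - S x 0) := by
    rw [h12 ν hν, ← mul_assoc, div_eq_mul_inv ν 2, ← mul_assoc, inv_mul_cancel₀ hν.ne', one_mul,
      ← (summable_sq_mul_of_weighted ha).tsum_sub (summable_sq_mul_of_weighted h5), ← tsum_mul_left]
    exact tsum_congr fun x => by ring
  rw [hHelf] at hMν
  have hM : max M 0 < ∑' x : ℤ, (x : ℝ) ^ 2 / 2 * (Sb ν x - S x 0) := by linarith
  obtain ⟨k, hk, hMk⟩ := exists_infrared_deficit_of_sq_moment ha h5 hcons hM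
  refine ⟨k, hk, ν, hν, hνν₁, ?_⟩
  simpa only [hfh, hχk] using hMk

end Summit.AtomisticToContinuum.FouriersLaw.Theorems.UnboundedHeatVariance.Sketch

end
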